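import Summits.BirchSwinnertonDyer.BirchSwinnertonDyer.Theorems.ResidualThetaTransportAtTwoSignedMuVanishingAtTwoPlusNeronMu
import HarnessLib

/-!
# Route `ResidualThetaTransportAtTwo`, crux Kμ⁺ `SignedMuVanishingAtTwoPlus` (stmt-BirchSwinnertonDyer-20689):
# the period index IS the Manin constant — `v_p(Ω_W / Ω⁺_f) = v_p(c₀)` for `E[p]` irreducible — so the
# analytic child at `W` reads **`μ(L♭_f) = v₂(c₀)`**, `c₀` = Manin constant of the optimal curve

Cell `bsd-wall`, width seat `bsd-wall-rtt-p4-w2` on the lead line `birth`. THEOREMS ONLY (no `def`, no named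
fact, no `sorry`); route-independent helper `--supports` the crux (only `IsNewformOf`, `IsPollackPair`,
`ModularParametrizationData`, `Λ`-algebra appear); nothing about any curve is asserted, no Manin-constant fact
is used, and BSD is not proved by this. Companion of this seat's `…SignedMuVanishingAtTwoPlusNeronMu`
(p578937: the bookkeeping `μ(G) = m` at `(W, f, ϖ, L♯, L♭)` ⟺ `v₂(ϖ) + μ(L♭) = 0` ⟺ `μ(L♭) = v₂(Ω_W/Ω⁺_f)`).

The tree's `SkinnerUrban2014.exists_unit_mul_plusPeriod_of_irreducible_anyPrime` proves
`Ω(W) = u · Ω⁺_f`, `‖u‖_p = 1`, GRANTED that the Manin constant `c₀` of the lattice-optimal datum is prime to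
`p`. Its proof in fact shows more, with no hypothesis on `c₀`: for `W/ℚ` globally minimal with `E[p]`
irreducible and newform `f ∈ S₂(Γ₀(N))`,
* `exists_optimalDatum_realPeriodRat_eq_unit_mul_maninConstant_mul_plusPeriod` — there is a lattice-optimal
  datum `(W₀, D₀)` at level `N` with newform `f` (Edixhoven: `Λ_{W₀} = c₀ Λ_f`, the strong Weil curve) and
  `u ∈ ℚ`, `‖u‖_p = 1`, with **`Ω(W) = u · |c₀| · Ω⁺_f`** (`u = a/q` from an isogeny `W → W₀` of degree
  prime to `p`: `exists_isogeny_not_dvd_degree_of_irreducible`, `exists_int_mul_realPeriodRat_eq_of_isogeny`,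
  `realPeriodRat_eq_abs_mul_plusPeriod_of_latticeEq`);
* `padicValRat_periodIndex_eq_padicValInt_maninConstant` — hence for ANY `u'` with `Ω(W) = u' · Ω⁺_f`:
  **`v_p(u') = v_p(c₀)`** — the `p`-adic valuation of the period index is that of the Manin constant;
* at `p = 2` (`forall_mu_eq_iff_mu_eq_padicValInt_maninConstant`): for a Pollack pair `(L♯, L♭)` of `f` at
  `2` and the period ratio `ϖ` (`ϖ Ω_W = Ω⁺_f`), the analytic bookkeeping of Kμ⁺ at `W` — «`μ(G) = m`
  whenever `ι G = 2^m ϖ ι L♭`» — holds **iff `μ(L♭_f) = v₂(c₀)`**. Manin's conjecture `c₀ = 1` (Abbes–Ullmo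
  Thm. A gives `2 ∤ c₀` for `2 ∤ N`) makes the right side `μ(L♭_f) = 0`; WITHOUT it, the child 21437 at `W`
  is the statement that the `2`-adic `μ`-invariant of Pollack's flat `L`-function equals the `2`-adic
  valuation of the Manin constant of the `X₀(N)`-optimal curve isogenous to `W` — two independently
  certifiable integers per class (`c₀` from the optimal curve, `μ(L♭_f)` from one Mazur–Tate layer,
  rtt-p4-w3's `…FlatLayer`);
* `exists_periodUnit_of_forall_optimal_not_dvd_maninConstant` — the per-class PERIOD-UNIT certificate: if the
  Manin constant of every lattice-optimal datum at level `N` with newform `f` is prime to `p`, then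
  `Ω(W) = u Ω⁺_f` with `‖u‖_p = 1` (the tree theorem, displayed for the line's stub `stub_periodUnitAtTwo`).

References: R. Greenberg, V. Vatsal, Invent. Math. 142 (2000) §3 Rem. 3.4 [GreenbergVatsal2000]; B. Edixhoven,
Progr. Math. 89 (1991) Prop. 2, §1 [EdixhovenManin1991]; J. E. Cremona, *Algorithms for modular elliptic
curves* (1997) §2.8 [CremonaAlgorithms1997]; R. Pollack, Duke Math. J. 118 (2003) Prop. 6.18 [Pollack2003];
A. Abbes, E. Ullmo, Compositio Math. 103 (1996) Thm. A [AbbesUllmo1996].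
-/

set_option autoImplicit false
set_option linter.dupNamespace false

noncomputable section

open scoped Classical MatrixGroups ModularForm

open CongruenceSubgroup WeierstrassCurve Literature.NumberTheory.EllipticCurves
  Literature.NumberTheory.EllipticCurves.ModularForms Literature.NumberTheory.EllipticCurves.SkinnerUrban2014
  Summit.BirchSwinnertonDyer.Rank1Residual.Supersingular Summit.BirchSwinnertonDyer.Rank1Residual.X1

namespace Summit.BirchSwinnertonDyer.BirchSwinnertonDyer.Theorems.SignedMuAtTwo

section AnyPrime

variable {W : WeierstrassCurve ℚ} [W.IsElliptic] [W.IsGloballyMinimal] {N : ℕ} [NeZero N]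
  {f : CuspForm (Gamma0 N) 2} {p : ℕ} [Fact p.Prime]

/-- **`Ω(W) = u · |c₀| · Ω⁺_f` with `‖u‖_p = 1`, NO hypothesis on the Manin constant.** For `W/ℚ` globally
minimal with `E[p]` irreducible and newform `f ∈ S₂(Γ₀(N))`, there is a lattice-optimal datum `(W₀, D₀)` at
level `N` with newform `f` (`Λ_{W₀} = c₀ Λ_f`; Edixhoven's integrality `edixhoven_int_of_neronLattice_eq_smul_periodLattice`)
and `u ∈ ℚ` with `‖u‖_p = 1` and `Ω(W) = u · |c₀| · Ω⁺_f` — `u = a/q` for an isogeny `W → W₀` of degree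
`d` prime to `p`, `q ∣ d`, `ab = d`. [cite: GreenbergVatsal2000, §3, Remark 3.4] [cite: EdixhovenManin1991, Prop. 2 and §1]
[cite: CremonaAlgorithms1997, §2.8 (p. 26)] -/
theorem exists_optimalDatum_realPeriodRat_eq_unit_mul_maninConstant_mul_plusPeriod
    (hirr : W.HasIrreducibleModPGaloisRep p) (hf : IsNewformOf W f) :
    ∃ (W₀ : WeierstrassCurve ℚ) (_ : W₀.IsElliptic) (_ : W₀.IsGloballyMinimal)
      (D₀ : ModularParametrizationData W₀ N), D₀.f = f ∧
      (∀ z ∈ D₀.L.lattice, ∃ w ∈ periodLattice D₀.f, z = D₀.c * w) ∧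
      ∃ u : ℚ, ‖(u : ℚ_[p])‖ = 1 ∧ W.realPeriodRat = u * |(D₀.c : ℝ)| * plusPeriod f := by
  have hpP : p.Prime := Fact.out
  -- a datum of `W` at level `N`, with newform `f`
  obtain ⟨D⟩ := Literature.NumberTheory.Automorphic.nonempty_modularParametrizationData_of_isNewformOf hf
  have hDf : D.f = f := D.isNewformOf.unique hf
  subst hDf
  -- the optimal datum on a globally minimal model of the strong Weil curve
  obtain ⟨W₀, hW₀, hW₀', D₀, hf₀, hiso, hopt, -⟩ :=
    D.exists_optimalDatum_of_edixhoven
      (fun hf' hL' q hq hq' ↦ edixhoven_int_of_neronLattice_eq_smul_periodLattice_holds hf' hL' q hq hq')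
  -- an isogeny `W → W₀` of degree prime to `p`
  obtain ⟨ψ, hψ⟩ := exists_isogeny_not_dvd_degree_of_irreducible (W := W) (W' := W₀)
    (Nat.cast_ne_zero.mpr hpP.ne_zero) hirr hiso
  -- the lattice step (full periods) and the optimal-curve step (exact)
  obtain ⟨q, a, b, hq0, hqd, hab, hqa⟩ := exists_int_mul_realPeriodRat_eq_of_isogeny D D₀ ψ
  have hm := D₀.realPeriodRat_eq_abs_mul_plusPeriod_of_latticeEq hopt
  rw [hf₀] at hm
  have hq0' : (q : ℝ) ≠ 0 := by exact_mod_cast hq0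
  -- `a`, `q` are prime to `p`
  have hpa : ¬ (p : ℤ) ∣ a := fun h ↦ hψ (Int.natCast_dvd_natCast.mp (hab ▸ h.mul_right b))
  have hpq : ¬ (p : ℤ) ∣ q := fun h ↦ hψ (Int.natCast_dvd_natCast.mp (h.trans hqd))
  -- an integer prime to `p` is a `p`-adic unit (tree: `BinaryQuartic.norm_intCast_eq_one`, kept local)
  have hunit : ∀ {z : ℤ}, ¬ (p : ℤ) ∣ z → ‖(z : ℚ_[p])‖ = 1 := fun h ↦
    le_antisymm (Padic.norm_int_le_one _) (not_lt.mp fun hlt ↦ h (Padic.norm_intCast_lt_one_iff.mp hlt))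
  refine ⟨W₀, hW₀, hW₀', D₀, hf₀, hopt, (a : ℚ) / (q : ℚ), ?_, ?_⟩
  · rw [Rat.cast_div, Rat.cast_intCast, Rat.cast_intCast, norm_div, hunit hpa, hunit hpq, div_one]
  · -- `Ω(W) = (a/q) Ω(W₀) = (a/q) |c₀| Ω⁺_f`
    have h1 : W.realPeriodRat * (q : ℝ) = (a : ℝ) * (|(D₀.c : ℝ)| * plusPeriod D.f) := by
      rw [mul_comm, hqa, hm]
    rw [Rat.cast_div, Rat.cast_intCast, Rat.cast_intCast, div_mul_eq_mul_div, div_mul_eq_mul_div,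
      eq_div_iff hq0', h1, mul_assoc]

omit [W.IsGloballyMinimal] in
/-- **The `p`-adic valuation of the period index is that of the Manin constant**: with `(W₀, D₀)` and `u` as
above and ANY `u' ∈ ℚ` with `Ω(W) = u' · Ω⁺_f`, `u' = u |c₀|`, so `v_p(u') = v_p(c₀)`.
[cite: GreenbergVatsal2000, §3, Remark 3.4] [cite: EdixhovenManin1991, Prop. 2 and §1] -/
theorem padicValRat_periodIndex_eq_padicValInt_maninConstant (hf : IsNewformOf W f)
    {W₀ : WeierstrassCurve ℚ} {D₀ : ModularParametrizationData W₀ N} {u u' : ℚ} (hu : ‖(u : ℚ_[p])‖ = 1)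
    (hΩ : W.realPeriodRat = u * |(D₀.c : ℝ)| * plusPeriod f) (hΩ' : W.realPeriodRat = u' * plusPeriod f) :
    padicValRat p u' = padicValInt p D₀.c := by
  have hplus : 0 < plusPeriod f := IsNewform0.plusPeriod_pos_holds hf.1 hf.coeffField_eq_bot
  have hΩpos : 0 < W.realPeriodRat := W.realPeriodRat_pos_holds
  -- `u' = u |c₀|`
  have hu' : (u' : ℝ) = u * |(D₀.c : ℝ)| := mul_right_cancel₀ hplus.ne' (by rw [← hΩ', hΩ])
  have hu'q : u' = u * |(D₀.c : ℚ)| := by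
    have : ((u * |(D₀.c : ℚ)| : ℚ) : ℝ) = u * |(D₀.c : ℝ)| := by push_cast; rfl
    exact_mod_cast hu'.trans this.symm
  have hu0 : u ≠ 0 := by rintro rfl; simp at hu
  have hc0 : D₀.c ≠ 0 := by
    intro h0
    rw [h0, Int.cast_zero, abs_zero, mul_zero, zero_mul] at hΩ
    exact hΩpos.ne' hΩ
  have hc0' : (|(D₀.c : ℚ)| : ℚ) ≠ 0 := abs_ne_zero.mpr (Int.cast_ne_zero.mpr hc0)
  -- valuations: `v_p(u) = 0`, `v_p(|c₀|) = v_p(c₀)`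
  have hvu : padicValRat p u = 0 := by
    have hq : (u : ℚ_[p]) ≠ 0 := by exact_mod_cast hu0
    have h' := Padic.norm_eq_zpow_neg_valuation hq
    rw [hu, Padic.valuation_ratCast] at h'
    have hp1 : (1 : ℝ) < p := by exact_mod_cast (Fact.out : p.Prime).one_lt
    have := (zpow_eq_one_iff_right₀ (zero_le_one.trans hp1.le) hp1.ne').mp h'.symm
    omega
  rw [hu'q, padicValRat.mul hu0 hc0', hvu, zero_add, ← Int.cast_abs, padicValRat.of_int]
  -- `v_p(|c₀|) = v_p(c₀)`
  rcases abs_choice D₀.c with h | h <;> rw [h]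
  simp [padicValInt, Int.natAbs_neg]

/-- **Per-class PERIOD-UNIT certificate (the tree theorem, displayed).** If the Manin constant of every
lattice-optimal datum at level `N` with newform `f` is prime to `p`, then `Ω(W) = u · Ω⁺_f` with `‖u‖_p = 1`
(`SkinnerUrban2014.exists_unit_mul_plusPeriod_of_irreducible_anyPrime`; at `p = 2` on the habitat this is the
line's `stub_periodUnitAtTwo` at `W` from the ODDNESS of one Manin constant instead of Abbes–Ullmo).
[cite: GreenbergVatsal2000, §3, Remark 3.4] [cite: EdixhovenManin1991, Prop. 2 and §1] -/
theorem exists_periodUnit_of_forall_optimal_not_dvd_maninConstant (hirr : W.HasIrreducibleModPGaloisRep p)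
    (hf : IsNewformOf W f)
    (hc : ∀ (W₀ : WeierstrassCurve ℚ) [W₀.IsElliptic] [W₀.IsGloballyMinimal]
      (D₀ : ModularParametrizationData W₀ N), D₀.f = f →
      (∀ z ∈ D₀.L.lattice, ∃ w ∈ periodLattice D₀.f, z = D₀.c * w) → ¬ (p : ℤ) ∣ D₀.maninConstant) :
    ∃ u : ℚ, ‖(u : ℚ_[p])‖ = 1 ∧ W.realPeriodRat = u * plusPeriod f :=
  exists_unit_mul_plusPeriod_of_irreducible_anyPrime W p hirr f hf hc

end AnyPrime

/-! ## At `p = 2`: the analytic bookkeeping of Kμ⁺ at `W` ⟺ `μ(L♭_f) = v₂(c₀)` -/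

section Two

variable {W : WeierstrassCurve ℚ} [W.IsElliptic] [W.IsGloballyMinimal] {N : ℕ} [NeZero N]
  {f : CuspForm (Gamma0 N) 2}

/-- **THE MANIN READING of the analytic child at `W` (no Manin-constant fact used).** For `W/ℚ` globally
minimal with `E[2]` irreducible, newform `f`, period ratio `ϖ` (`ϖ Ω_W = Ω⁺_f`) and a Pollack pair
`(L♯, L♭)` at `2`: there is a lattice-optimal datum `(W₀, D₀)` at level `N` with newform `f` (the strong Weil
curve and its Manin constant `c₀ = D₀.c`) such that «`μ(G) = m` for every `G ∈ Λ`, `m ≥ 0` with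
`ι G = 2^m ϖ ι L♭`» holds **iff `μ(L♭) = v₂(c₀)`**. [cite: GreenbergVatsal2000, §3, Remark 3.4]
[cite: Pollack2003, Prop. 6.18] [cite: EdixhovenManin1991, Prop. 2 and §1] -/
theorem exists_optimalDatum_forall_mu_eq_iff_mu_eq_padicValInt_maninConstant
    (hirr : W.HasIrreducibleModPGaloisRep 2) (hf : IsNewformOf W f) {ϖ : ℚ}
    (hϖ : (ϖ : ℝ) * W.realPeriodRat = plusPeriod f) {Lplus Lminus : IwasawaAlgebra 2}
    (hP : IsPollackPair f 2 Lplus Lminus) :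
    ∃ (W₀ : WeierstrassCurve ℚ) (_ : W₀.IsElliptic) (_ : W₀.IsGloballyMinimal)
      (D₀ : ModularParametrizationData W₀ N), D₀.f = f ∧
      (∀ z ∈ D₀.L.lattice, ∃ w ∈ periodLattice D₀.f, z = D₀.c * w) ∧
      ((∀ (G : IwasawaAlgebra 2) (m : ℕ), iwasawaToPowerSeries 2 G =
          PowerSeries.C ((2 : ℚ_[2]) ^ m * (ϖ : ℚ_[2])) * iwasawaToPowerSeries 2 (kobayashiL 1 Lplus Lminus) →
          MuLambda.mu G = m) ↔
        (MuLambda.mu Lminus : ℤ) = padicValInt 2 D₀.c) := by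
  obtain ⟨W₀, hW₀, hW₀', D₀, hf₀, hopt, u, hu, hΩ⟩ :=
    exists_optimalDatum_realPeriodRat_eq_unit_mul_maninConstant_mul_plusPeriod (p := 2) hirr hf
  refine ⟨W₀, hW₀, hW₀', D₀, hf₀, hopt, ?_⟩
  -- the period index `u' = ϖ⁻¹`
  have hϖ0 : ϖ ≠ 0 := periodRatio_ne_zero hf hϖ
  have hϖ0' : (ϖ : ℝ) ≠ 0 := by exact_mod_cast hϖ0
  have hΩ' : W.realPeriodRat = (ϖ⁻¹ : ℚ) * plusPeriod f := by
    rw [← hϖ, Rat.cast_inv, ← mul_assoc, inv_mul_cancel₀ hϖ0', one_mul]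
  rw [forall_mu_eq_iff_mu_eq_padicValRat_periodIndex hf hϖ hΩ' hP,
    padicValRat_periodIndex_eq_padicValInt_maninConstant hf hu hΩ hΩ']

omit [NeZero N] in
/-- On the HABITAT (good supersingular at `2`, so `E[2]` is irreducible — `P2.irr_two_of_goodSS_two`) the
irreducibility binder is discharged: the Manin reading of the analytic child at a habitat curve.
[cite: GreenbergVatsal2000, §3, Remark 3.4] [cite: Pollack2003, Prop. 6.18] -/
theorem exists_optimalDatum_forall_mu_eq_iff_mu_eq_padicValInt_maninConstant_of_goodSS [NeZero N]
    (hss : Rank1Residual.GoodSS W 2) (hf : IsNewformOf W f) {ϖ : ℚ}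
    (hϖ : (ϖ : ℝ) * W.realPeriodRat = plusPeriod f) {Lplus Lminus : IwasawaAlgebra 2}
    (hP : IsPollackPair f 2 Lplus Lminus) :
    ∃ (W₀ : WeierstrassCurve ℚ) (_ : W₀.IsElliptic) (_ : W₀.IsGloballyMinimal)
      (D₀ : ModularParametrizationData W₀ N), D₀.f = f ∧
      (∀ z ∈ D₀.L.lattice, ∃ w ∈ periodLattice D₀.f, z = D₀.c * w) ∧
      ((∀ (G : IwasawaAlgebra 2) (m : ℕ), iwasawaToPowerSeries 2 G =
          PowerSeries.C ((2 : ℚ_[2]) ^ m * (ϖ : ℚ_[2])) * iwasawaToPowerSeries 2 (kobayashiL 1 Lplus Lminus) →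
          MuLambda.mu G = m) ↔
        (MuLambda.mu Lminus : ℤ) = padicValInt 2 D₀.c) :=
  exists_optimalDatum_forall_mu_eq_iff_mu_eq_padicValInt_maninConstant
    (Rank1Residual.P2.irr_two_of_goodSS_two W hss) hf hϖ hP

end Two

end Summit.BirchSwinnertonDyer.BirchSwinnertonDyer.Theorems.SignedMuAtTwo

end
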